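import Mathlib
import Summits.NavierStokesRegularity.NavierStokesRegularity.Theses.QuarterLogPincer
import Literature.Analysis.FluidPDE.ClassicalSolution
import Literature.Analysis.FluidPDE.SelfSimilar
import Literature.Analysis.FluidPDE.ChaeWolfRemovingDSS
import Literature.Analysis.FluidPDE.PineauVicolOneSlice
import Literature.Analysis.FluidPDE.DongZhangTimeAnalyticity
import Literature.Barriers.NavierStokesRegularity.NearOneDssTypeIExclusion
import Summits.NavierStokesRegularity.NavierStokesRegularity.Theorems.QuarterLogPincerFlatWindowDefs
import Summits.NavierStokesRegularity.NavierStokesRegularity.Theorems.QuarterLogPincerTypeIQuantSubcubicExpFlatWindowSliceDictionary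
import Summits.NavierStokesRegularity.NavierStokesRegularity.Theorems.QuarterLogPincerTypeIQuantSubcubicExpFlatWindowAnnulusPressure
import Summits.NavierStokesRegularity.NavierStokesRegularity.Theorems.QuarterLogPincerTypeIQuantSubcubicExpFlatWindowExplicitWindow
import Summits.NavierStokesRegularity.NavierStokesRegularity.Theorems.QuantisedSymmetryPolyhedralDssProfileExistsStubAncientMildOfClassicalTypeI
import Literature.Analysis.Calculus.IteratedDerivCompFactorial
import Literature.Analysis.FluidPDE.TypeIAncientMild
import Literature.Analysis.FluidPDE.TypeIAncientMildRescale
import Literature.Analysis.FluidPDE.AncientSimilarityVariables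
import Literature.Analysis.FluidPDE.HyperbolicDSSOrbit

/-!
# Line `analytic-window` — DSS-wall rung line filed under crux `QuarterLogPincer.TypeIQuantSubcubicExp`
(stmt-NavierStokesRegularity-24077). Seat ns-idea-7 g6, lens «nearmiss», target «DSS wall».

VERSION 4 (2026-08-28 16:3xZ, same seat; after ns-afl-r1 g9's refuter briefing 15:32:10Z): S2′ is SPLIT and its bookkeeping
half PROVED — S2a `stub_slabJets` (class-uniform real-analyticity jets `‖Dᵏ(uncurry u)(−1,x)‖ ≤ A k! τᵏ` of Type-I ancient
MILD solutions at time `−1`: the Literature-grade re-filing the refuter identified) is now the ONLY `sorry`; S2b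
`profileGevreyBoundMild_of_slabJets` (cut-off extension + Faà di Bruno along the similarity curve + Leibniz + scaling
covariance) is PROVED, so `profileGevreyBoundMild_exists` (v3's stub statement) is a theorem modulo S2a.
VERSION 3 (2026-08-28 15:4xZ, same seat; answers idea-crit-7 g3 BACKSTOP VERDICT 15:07:08Z PASS-WITH-PRICE):
(P1) the RUNG is now the universally-quantified conditional `analyticWindow_rung` (for ALL admissible data
`δ₀, Cp, s₀, C₁, θ` — one-slice threshold, annulus pressure, Gevrey profile lines — the window
`exp(θ/(4 log(9C₁/(θδ₀))))` excludes DSS; sorry-free, it does not even use S2) plus the ∃-form WITH DEFINING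
CONJUNCTS `analyticWindow_rung_exists` (uses S2); the v1/v2 ∃-ranges form is kept only as
`analyticWindow_rung_ranges`, documented as IMPLIED BY THE TREE rung p633176 by arithmetic (the critic's RED.lean);
(P2) S2 is restated over the Oseen-MILD class `IsTypeIAncientMild C₀` (`ProfileGevreyBoundMild`,
`stub_profileGevreyBoundMild` = the ONLY sorry), the step «envelope-class classical ⇒ mild» being the TREE theorem
`Theorems.PolyhedralDssProfileExists.Birth.isTypeIAncientMild_of_classical_typeI` (KNSS 2009 Thm 6.1), so
`profileGevreyBound_exists` (the v1/v2 S2 statement) is DERIVED; (P3) `window_comparison` PROVES that at the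
acceleration constant the same Gevrey data certify (`B_G = 2C₁/θ²`, `accel_of_gevrey`) the analytic log-window
dominates the tree-shaped linear window `exp(δ₀/(2B_G))` whenever `9C₁/(θδ₀) ≥ 32` (so whenever `δ₀ ≤ 9/32`);
against the tree's OPTIMAL `B` the comparison `θB ≥ 2δ₀ log(9C₁/(θδ₀))` is UNDECIDED (no constant is pinned in
tree or print).  VERSION 2 (15:1xZ): S1 `stub_gevreyFlatness` is now PROVED in this file
(`gevreyFlatness_holds`, with `factorial_le_stirling_upper` = Stirling's upper bound from
`Stirling.stirlingSeq'_antitone`, `cube_le_exp`, `key_ineq` = `e²x^{3/2}e^{−x} ≤ 9e^{−x/2}`, and the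
optimisation `flat_optimise`); the ONLY `sorry` left is S2a `stub_slabJets` (v4; v3 `stub_profileGevreyBoundMild`, v1/v2 `stub_profileGevreyBound` are now derived; the load-bearing PDE
input).  Statements of v1 unchanged.

**No summit is proved by this line, and it does NOT conclude the crux `TypeIQuantSubcubicExp`.**
It is a RUNG line on the crux's wall (the only open stub of the registered skeleton
`Lines/thin_cascade.lean` v5 is S3 `stub_thinCascadeLiouville` = the DSS / Type-I ancient Liouville
wall for EVERY factor `λ > 1`; this line, like `Lines/flat_window.lean`, is near-one only).

## Measured deficit and the single input this line improves (lens «nearmiss»)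

The near-one exclusion window.  Tree rung `FlatWindow.removingDss_explicitWindow` (p633176, from
ns-idea-7 g4's line `flat_window`): every `λ`-DSS classical ancient solution in the envelope class
`HasTypeIDecay C₀` with `log λ ≤ δ₀(C₀)/(2B(C₀))` vanishes, where `δ₀` is the ONE-SLICE THRESHOLD of
Pineau–Vicol 2026 Thm 1.9 (tree `pineauVicol2026_oneSlice_regularity_holds`; `δ₀ = K_H⁻¹K₂⁻¹θ_*²/8`,
a product of ε-regularity constants, PV p. 83) and `B` the acceleration bound `‖∂ₛ²U‖ ≤ B`.  The
input producing the window there is FLATNESS of the `S = 2 log λ`-periodic profile lines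
`s ↦ U(s,y) = lerayOrbit u s y`: Poincaré-in-`s` gives `‖∂ₛU‖ ≤ B·S`, LINEAR in the period, so the
window is LINEAR in the tiny threshold `δ₀`.  (Pineau–Vicol's own §7–8 uses the same linear
smallness of the fluctuation, Lemma 7.2: `|Ũ| ≤ C S/(1+|y|)`, arXiv:2607.09619 p. 32.)

## The lever (new on this wall): TIME-ANALYTICITY ⟹ super-exponential flatness of short-period orbits

Classical ancient solutions in the envelope class are mild and bounded on every backward window, hence
jointly real-analytic in space-time with SCALE-INVARIANT radii (space `∝ √(−t)`, time `∝ (−t)`: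
Lemarié-Rieusset 2016 Thm 9.12 = tree `lemarieRieusset2016_local_analyticity_holds` and the complexified
Oseen scheme `OseenSchemeComplex*`; Guberović 2010 / Bradshaw–Grujić–Kukavica 2016 Thm 2.4.1 = tree
`guberovic2010_analyticity_radius_holds`, `exists_tube_extension_of_typeI_ancient_mild`; Dong–Zhang 2020
Thm 2 = tree `DongZhang2020_timeDerivative_bounds_boundedMild_holds`).  Composed with the entire curve
`s ↦ (e^{−s/2}y, −e^{−s})` (Faà di Bruno for factorial jets, tree
`Literature.Analysis.Calculus.norm_iteratedFDeriv_comp_le_of_factorial`) this makes every profile line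
GEVREY-1 in `s` uniformly on balls: `‖∂ₛⁿU(s,y)‖ ≤ C₁ n!/θⁿ` for `‖y‖ ≤ R` (stub
`stub_profileGevreyBoundMild` (v3; v1/v2 `stub_profileGevreyBound`); `θ = θ(C₀,R)` is the log-time analyticity half-width of the class).  For an
`S`-PERIODIC Gevrey-1 curve the tree's Poincaré lemma `periodic_deriv_norm_le` ITERATES
(`‖g'‖ ≤ S‖g''‖ ≤ … ≤ Sⁿ⁻¹‖g⁽ⁿ⁾‖ ≤ C₁ n! Sⁿ⁻¹/θⁿ`) and the choice `n = ⌊θ/S⌋` with Stirling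
(`Stirling.stirlingSeq'_antitone`) gives SUPER-EXPONENTIAL flatness (S1, PROVED here as `gevreyFlatness_holds`; v1 name `stub_gevreyFlatness`):

  `‖∂ₛU(s,y)‖ ≤ 9 C₁ θ⁻¹ exp(−θ/(2S))`   (`0 < S ≤ θ`),

so one quiet slice (`‖∂ₛU‖ ≤ δ₀` on the similarity ball `‖y‖ ≤ 2e^{s₀/2}` that Thm 1.9 inspects)
holds as soon as `S ≤ θ/(2 log(9C₁/(θδ₀)))`.  Window formula (composition `analyticWindow_rung`,
kernel-checked from the two stubs and the LANDED obligations of `flat_window` — dictionary p629490,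
annulus pressure p630589, zoom-down + one-slice threshold p633176):

  `λ_*(C₀) ≥ exp( θ / (4 log(9C₁/(θ δ₀))) )`,

LOGARITHMIC in the one-slice threshold `δ₀` (tree: linear).  Reading: up to the factor
`4|log(θδ₀/9C₁)|` the near-one exclusion window IS the log-time analyticity width `θ(C₀, 2e^{s₀/2})` of the
Type-I envelope class — flatness is (nearly) free for short-period analytic orbits, and the only PDE
threshold left in the window enters through its logarithm.

## Honest framing
Near-one lane only (barrier `NearOneDssTypeIExclusion`: small-constant class); S3 of `thin_cascade` is
NOT narrowed; expected novelty grade: VARIANT-OF `flat_window` / Pineau–Vicol Thm 1.6 with a NEW INPUT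
(time-analyticity / Gevrey flatness — absent from Chae–Wolf 2017 §4 and Pineau–Vicol 2026 §6–8, which use
`C¹`/`C²`-in-`s` smallness linear in `S`).  The improvement over the tree window is strict exactly when
`δ₀ < θ·2B/(4 log(9C₁/(θδ₀)))`, i.e. whenever the one-slice threshold lies below the analyticity width (up
to the log) — the expected regime, not proved here: INSTRUMENT ROW = compute `θ(C₀,R)`, `C₁(C₀,R)` from the
Oseen-scheme constants (`ε = 1/(64C_B²K_G²)`, `C = 2K_G` of `lemarieRieusset2016_local_analyticity`) and
compare with `δ₀(C₀)`, `B(C₀)`.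

## Bears on
* rung `N6d`/DSS wall of LADDER-NS; crux item stmt-NavierStokesRegularity-24077 via its only open stub
  `stub_thinCascadeLiouville` (near-one window made explicit with a structurally better threshold dependence);
* barrier `Literature.Barriers.NavierStokesRegularity.NearOneDssTypeIExclusion` (evasion conjuncts; this
  line, like `flat_window`, goes through the one-slice conjunct).

## Cheapest falsifier
S1 (`gevreyFlatness_holds`) is PROVED in this file (v2), so nothing is left to falsify there.  The line dies if `stub_slabJets` is false AS TYPED: a classical
ancient envelope-class solution whose profile line at some `‖y‖ ≤ R` is NOT Gevrey-1 in `s` with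
class-uniform constants — impossible for MILD solutions (space-time analyticity with scale-invariant radii),
so the instrument is: «classical on `(−∞,0) × ℝ³` + `HasTypeIDecay C₀` ⇒ Oseen-mild» (tree:
the KNSS/Pineau–Vicol pressure identification used by `stub_annulusPressure`, p630589).  Serrin's
non-mild example `a(t)∇h(x)` (no time regularity) is excluded by the envelope decay + whole-space classicality.

References: Chae–Wolf 2017 (arXiv:1610.09464) Thm 1.3; Pineau–Vicol 2026 (arXiv:2607.09619) Thm 1.6, Thm 1.9,
Lemma 7.2, §8 (8.1)–(8.2); Dong–Zhang, J. Funct. Anal. 279 (2020) 108563 (arXiv:1907.01687) Thm 2;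
Lemarié-Rieusset 2016 Thm 9.12; Bradshaw–Grujić–Kukavica, LMS LN 430 (2016) Thm 2.3.1/2.4.1 and JDE 259 (2015)
Thm 2.3; Grujić–Kukavica, JFA 152 (1998); Albritton–Barker, ARMA 232 (2019) (arXiv:1811.00502) §§3–4 (the
measured-deficit side of the MINT).
-/

noncomputable section

-- the summit-side namespace repeats a component by design (D-0017)
set_option linter.dupNamespace false

namespace Summit.NavierStokesRegularity.NavierStokesRegularity.Cruxes.TypeIQuantSubcubicExp.AnalyticWindow

open MeasureTheory Set Function Filter Topology Metric
open scoped Nat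
open Literature.Analysis Literature.Analysis.FluidPDE Literature.Analysis.Calculus
open Summit.NavierStokesRegularity.NavierStokesRegularity.Cruxes.TypeIQuantSubcubicExp.FlatWindow

/-! ### Objects -/

/-- **Gevrey-1 (real-analytic) profile lines on a similarity ball.** Every classical ancient solution in
the envelope class `HasTypeIDecay C₀` has, for every label `‖y‖ ≤ R`, a smooth profile line
`s ↦ U(s,y) = lerayOrbit u s y` with `‖∂ₛⁿU(s,y)‖ ≤ C₁·n!/θⁿ` for all `n ≥ 1` and all `s`
(`θ` = log-time analyticity half-width of the class on the ball, `C₁` = strip bound). -/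
def ProfileGevreyBound (C₀ R C₁ θ : ℝ) : Prop :=
  ∀ (u : ℝ → EuclideanSpace ℝ (Fin 3) → EuclideanSpace ℝ (Fin 3)) (p : ℝ → EuclideanSpace ℝ (Fin 3) → ℝ),
    IsClassicalNSSolutionOn (Iio 0) 1 0 u p → HasTypeIDecay C₀ u →
    ∀ y : EuclideanSpace ℝ (Fin 3), ‖y‖ ≤ R →
      (∀ n : ℕ, ContDiff ℝ n (profileLine u y)) ∧
      ∀ n : ℕ, 1 ≤ n → ∀ s : ℝ, ‖iteratedDeriv n (profileLine u y) s‖ ≤ C₁ * (n ! : ℝ) / θ ^ n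

/-- **S2 in mild form (v3; critic P2).** The same Gevrey-1 bounds stated over the Oseen-MILD Type-I ancient
class `IsTypeIAncientMild C₀` (KNSS gauge: joint smoothness on the open past, `div u = 0`, the Oseen
representation `u(t) = e^{(t−s)Δ}u(s) − B_s(u,u)(t)` between all `s < t < 0`, temporal bound `‖u(t,x)‖ ≤ C₀/√(−t)`)
— the class on which the tree's analyticity facts act (`IsTypeIAncientMild.analyticOnNhd_slice_univ`,
Lemarié-Rieusset Thm 9.12; Dong–Zhang for time).  The envelope class maps into it by the TREE theorem
`isTypeIAncientMild_of_classical_typeI` (KNSS 2009 Thm 6.1 mildness clause), see `profileGevreyBound_of_mild`: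
the «classical ⇒ mild» step is discharged BY NAME and the open stub is pure analysis of mild solutions. -/
def ProfileGevreyBoundMild (C₀ R C₁ θ : ℝ) : Prop :=
  ∀ (u : ℝ → EuclideanSpace ℝ (Fin 3) → EuclideanSpace ℝ (Fin 3)), IsTypeIAncientMild C₀ u →
    ∀ y : EuclideanSpace ℝ (Fin 3), ‖y‖ ≤ R →
      (∀ n : ℕ, ContDiff ℝ n (profileLine u y)) ∧
      ∀ n : ℕ, 1 ≤ n → ∀ s : ℝ, ‖iteratedDeriv n (profileLine u y) s‖ ≤ C₁ * (n ! : ℝ) / θ ^ n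

/-- Mild form ⇒ envelope-class form, by the tree's `isTypeIAncientMild_of_classical_typeI` (KNSS 2009 Thm 6.1). -/
theorem profileGevreyBound_of_mild {C₀ R C₁ θ : ℝ} (h : ProfileGevreyBoundMild C₀ R C₁ θ) :
    ProfileGevreyBound C₀ R C₁ θ := fun u _p hsol hdec y hy =>
  h u (Summit.NavierStokesRegularity.NavierStokesRegularity.Theorems.PolyhedralDssProfileExists.Birth.isTypeIAncientMild_of_classical_typeI
    hsol hdec) y hy

/-- Gevrey data certify an acceleration constant on the inspected ball: `‖∂ₛ²U(s,y)‖ ≤ 2C₁/θ²` for `‖y‖ ≤ R`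
(the comparison point `B_G` of `window_comparison`). -/
theorem accel_of_gevrey {C₀ R C₁ θ : ℝ} (h : ProfileGevreyBound C₀ R C₁ θ)
    {u : ℝ → EuclideanSpace ℝ (Fin 3) → EuclideanSpace ℝ (Fin 3)} {p : ℝ → EuclideanSpace ℝ (Fin 3) → ℝ}
    (hsol : IsClassicalNSSolutionOn (Iio 0) 1 0 u p) (hdec : HasTypeIDecay C₀ u)
    {y : EuclideanSpace ℝ (Fin 3)} (hy : ‖y‖ ≤ R) (s : ℝ) :
    ‖iteratedDeriv 2 (profileLine u y) s‖ ≤ 2 * C₁ / θ ^ 2 := by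
  have h2 := (h u p hsol hdec y hy).2 2 (by norm_num) s
  have e : C₁ * ((2 : ℕ)! : ℝ) / θ ^ 2 = 2 * C₁ / θ ^ 2 := by simp [Nat.factorial]; ring
  rwa [e] at h2

/-- **One-slice threshold with the slice time displayed** — the body of `FlatWindow.OneSliceThreshold`
(Pineau–Vicol Thm 1.9 with threshold `δ₀`) at a given annulus-pressure bound `Cp` and slice parameter `s₀`:
flatness `‖pvSliceDefect‖ ≤ δ₀` on `B₁` at one time `t̄ ∈ (−e^{−s₀}, 0)` makes the apex regular. -/
def OneSliceThresholdAt (Cu δ₀ Cp s₀ : ℝ) : Prop :=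
  ∀ (u : ℝ → EuclideanSpace ℝ (Fin 3) → EuclideanSpace ℝ (Fin 3)) (p : ℝ → EuclideanSpace ℝ (Fin 3) → ℝ),
    IsClassicalNSSolutionOnRegion pvRegion 1 0 u p →
    (∀ t ∈ Ico (-1 : ℝ) 0, ∀ x ∈ ball (0 : EuclideanSpace ℝ (Fin 3)) 1, ‖u t x‖ ≤ Cu / (Real.sqrt (-t) + ‖x‖)) →
    (∀ t ∈ Ico (-1 : ℝ) 0, ∀ x : EuclideanSpace ℝ (Fin 3), 1 / 2 < ‖x‖ → ‖x‖ < 3 / 4 → |p t x| ≤ Cp) →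
    ∀ tbar : ℝ, -Real.exp (-s₀) < tbar → tbar < 0 →
      (∀ x ∈ ball (0 : EuclideanSpace ℝ (Fin 3)) 1, ‖pvSliceDefect u tbar x‖ ≤ δ₀) →
      ∃ r : ℝ, 0 < r ∧ ∃ M : ℝ, ∀ t : ℝ, -r ^ 2 < t → t < 0 → ∀ x ∈ ball (0 : EuclideanSpace ℝ (Fin 3)) r, ‖u t x‖ ≤ M

/-! ### The obligations: S1 (PROVED in v2 below, `gevreyFlatness_holds`) and S2 (the one open stub) -/

section GevreyFlatness
open Real

/-! ### S1 proved: super-exponential flatness of short-period Gevrey-1 orbits -/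

/-- Stirling upper bound `(m+1)! ≤ e √(m+1) ((m+1)/e)^{m+1}` from `Stirling.stirlingSeq'_antitone`. -/
theorem factorial_le_stirling_upper (m : ℕ) :
    ((m + 1)! : ℝ) ≤ exp 1 * √((m : ℝ) + 1) * (((m : ℝ) + 1) / exp 1) ^ (m + 1) := by
  have hanti := Stirling.stirlingSeq'_antitone (Nat.zero_le m)
  simp only [Function.comp, Nat.succ_eq_add_one, zero_add, Stirling.stirlingSeq_one] at hanti
  unfold Stirling.stirlingSeq at hanti
  push_cast at hanti
  have hN : (0 : ℝ) < (m : ℝ) + 1 := by positivity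
  have hpos : 0 < √(2 * ((m : ℝ) + 1)) * (((m : ℝ) + 1) / exp 1) ^ (m + 1) := by positivity
  rw [div_le_iff₀ hpos] at hanti
  have hsqrt : √(2 * ((m : ℝ) + 1)) = √2 * √((m : ℝ) + 1) := Real.sqrt_mul (by norm_num) _
  have h2 : (0 : ℝ) < √2 := by positivity
  calc ((m + 1)! : ℝ) ≤ exp 1 / √2 * (√(2 * ((m : ℝ) + 1)) * (((m : ℝ) + 1) / exp 1) ^ (m + 1)) := hanti
    _ = exp 1 * √((m : ℝ) + 1) * (((m : ℝ) + 1) / exp 1) ^ (m + 1) := by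
        rw [hsqrt]; field_simp

/-- `x³ ≤ 27 e^{x−3}` for `x ≥ 0` (from `1 + t ≤ eᵗ` at `t = x/3 − 1`, cubed). -/
theorem cube_le_exp (x : ℝ) (hx : 0 ≤ x) : x ^ 3 ≤ 27 * exp (x - 3) := by
  have h1 : x / 3 ≤ exp (x / 3 - 1) := by
    have := Real.add_one_le_exp (x / 3 - 1)
    linarith
  have h3 : (x / 3) ^ 3 ≤ exp (x / 3 - 1) ^ 3 := pow_le_pow_left₀ (by positivity) h1 3
  have h4 : exp (x / 3 - 1) ^ 3 = exp (x - 3) := by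
    rw [← Real.exp_nat_mul]; congr 1; push_cast; ring
  rw [h4] at h3
  have h5 : (x / 3) ^ 3 = x ^ 3 / 27 := by ring
  rw [h5, div_le_iff₀ (by norm_num : (0 : ℝ) < 27)] at h3
  linarith

/-- The numerical heart: `e² x^{3/2} e^{−x} ≤ 9 e^{−x/2}` for `x ≥ 1` (uses `27e ≤ 81`). -/
theorem key_ineq (x : ℝ) (hx : 1 ≤ x) :
    exp 1 ^ 2 * x * √x * exp (-x) ≤ 9 * exp (-(x / 2)) := by
  have hx0 : 0 ≤ x := by linarith
  have hA : 0 ≤ exp 1 ^ 2 * x * √x * exp (-x) := by positivity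
  have hB : 0 ≤ 9 * exp (-(x / 2)) := by positivity
  rw [← pow_le_pow_iff_left₀ hA hB two_ne_zero]
  have hsq : √x ^ 2 = x := Real.sq_sqrt hx0
  have hL : (exp 1 ^ 2 * x * √x * exp (-x)) ^ 2 = exp 1 ^ 4 * x ^ 3 * (exp (-x) * exp (-x)) := by
    have : (exp 1 ^ 2 * x * √x * exp (-x)) ^ 2 = exp 1 ^ 4 * x ^ 2 * √x ^ 2 * (exp (-x) * exp (-x)) := by
      ring
    rw [this, hsq]; ring
  have hR : (9 * exp (-(x / 2))) ^ 2 = 81 * exp (-x) := by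
    rw [mul_pow, sq (exp _), ← Real.exp_add, show -(x / 2) + -(x / 2) = -x by ring]; norm_num
  rw [hL, hR]
  have hcube := cube_le_exp x hx0
  have he4 : exp 1 ^ 4 * exp (x - 3) * (exp (-x) * exp (-x)) = exp 1 * exp (-x) := by
    rw [← Real.exp_nat_mul, ← Real.exp_add, ← Real.exp_add, ← Real.exp_add, ← Real.exp_add]
    congr 1; push_cast; ring
  have he3 : exp 1 ≤ 3 := by have := Real.exp_one_lt_d9; linarith
  have hpos : 0 ≤ exp 1 ^ 4 * (exp (-x) * exp (-x)) := by positivity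
  calc exp 1 ^ 4 * x ^ 3 * (exp (-x) * exp (-x))
      = x ^ 3 * (exp 1 ^ 4 * (exp (-x) * exp (-x))) := by ring
    _ ≤ (27 * exp (x - 3)) * (exp 1 ^ 4 * (exp (-x) * exp (-x))) :=
        mul_le_mul_of_nonneg_right hcube hpos
    _ = 27 * (exp 1 ^ 4 * exp (x - 3) * (exp (-x) * exp (-x))) := by ring
    _ = 27 * (exp 1 * exp (-x)) := by rw [he4]
    _ ≤ 27 * (3 * exp (-x)) := by
        have := mul_le_mul_of_nonneg_right he3 (Real.exp_pos (-x)).le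
        linarith
    _ = 81 * exp (-x) := by ring

/-- The optimisation step: if `D ≤ C₁ (m+1)! S^m/θ^{m+1}` for every `m`, `0 ≤ C₁` and `0 < S ≤ θ`, then
`D ≤ 9 C₁ θ⁻¹ e^{−θ/(2S)}` (take `m + 1 = ⌊θ/S⌋`, Stirling, `key_ineq`). -/
theorem flat_optimise {C₁ θ S D : ℝ} (hC : 0 ≤ C₁) (hS : 0 < S) (hSθ : S ≤ θ)
    (hD : ∀ m : ℕ, D ≤ C₁ * ((m + 1)! : ℝ) * S ^ m / θ ^ (m + 1)) :
    D ≤ 9 * C₁ / θ * exp (-(θ / (2 * S))) := by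
  have hθ : 0 < θ := lt_of_lt_of_le hS hSθ
  -- x = θ/S ≥ 1 and its integer part n = m + 1
  have hx1 : 1 ≤ θ / S := by rw [le_div_iff₀ hS]; linarith
  have hx0 : 0 ≤ θ / S := by linarith
  have hfl : ⌊θ / S⌋₊ ≠ 0 := (Nat.floor_pos.mpr hx1).ne'
  obtain ⟨m, hm⟩ := Nat.exists_eq_succ_of_ne_zero hfl
  have hNx : (m : ℝ) + 1 ≤ θ / S := by
    have := Nat.floor_le hx0
    rw [hm] at this; push_cast at this; linarith
  have hxN : θ / S < (m : ℝ) + 1 + 1 := by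
    have := Nat.lt_floor_add_one (θ / S)
    rw [hm] at this; push_cast at this; linarith
  have hN : (0 : ℝ) < (m : ℝ) + 1 := by positivity
  -- Stirling
  have hst := factorial_le_stirling_upper m
  have hDm := hD m
  have hstep1 : C₁ * ((m + 1)! : ℝ) * S ^ m / θ ^ (m + 1) ≤
      C₁ * (exp 1 * √((m : ℝ) + 1) * (((m : ℝ) + 1) / exp 1) ^ (m + 1)) * S ^ m / θ ^ (m + 1) := by
    have h0 : 0 ≤ S ^ m / θ ^ (m + 1) := by positivity
    have := mul_le_mul_of_nonneg_left hst hC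
    calc C₁ * ((m + 1)! : ℝ) * S ^ m / θ ^ (m + 1) = C₁ * ((m + 1)! : ℝ) * (S ^ m / θ ^ (m + 1)) := by ring
      _ ≤ C₁ * (exp 1 * √((m : ℝ) + 1) * (((m : ℝ) + 1) / exp 1) ^ (m + 1)) * (S ^ m / θ ^ (m + 1)) :=
          mul_le_mul_of_nonneg_right this h0
      _ = _ := by ring
  -- rewrite the Stirling expression as (e √N / S) · (N S/(e θ))^{m+1}
  have hrew : C₁ * (exp 1 * √((m : ℝ) + 1) * (((m : ℝ) + 1) / exp 1) ^ (m + 1)) * S ^ m / θ ^ (m + 1)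
      = C₁ * (exp 1 * √((m : ℝ) + 1) / S) * (((m : ℝ) + 1) * S / (exp 1 * θ)) ^ (m + 1) := by
    have hS0 : S ≠ 0 := hS.ne'
    have hθ0 : θ ≠ 0 := hθ.ne'
    have he0 : exp 1 ≠ 0 := (Real.exp_pos 1).ne'
    rw [div_pow, div_pow, mul_pow, mul_pow]
    field_simp
    ring
  -- the geometric factor is ≤ e^{-(m+1)} ≤ e^{1 - θ/S}
  have hq : ((m : ℝ) + 1) * S / (exp 1 * θ) ≤ (exp 1)⁻¹ := by
    have h1 : ((m : ℝ) + 1) * S ≤ θ := by rwa [le_div_iff₀ hS] at hNx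
    rw [div_le_iff₀ (by positivity)]
    calc ((m : ℝ) + 1) * S ≤ θ := h1
      _ = (exp 1)⁻¹ * (exp 1 * θ) := by field_simp
  have hq0 : 0 ≤ ((m : ℝ) + 1) * S / (exp 1 * θ) := by positivity
  have hgeom : (((m : ℝ) + 1) * S / (exp 1 * θ)) ^ (m + 1) ≤ exp (1 - θ / S) := by
    calc (((m : ℝ) + 1) * S / (exp 1 * θ)) ^ (m + 1) ≤ ((exp 1)⁻¹) ^ (m + 1) := pow_le_pow_left₀ hq0 hq _
      _ = exp (-((m : ℝ) + 1)) := by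
          rw [← Real.exp_neg, ← Real.exp_nat_mul]; congr 1; push_cast; ring
      _ ≤ exp (1 - θ / S) := Real.exp_le_exp.mpr (by linarith)
  have hsqrt : √((m : ℝ) + 1) ≤ √(θ / S) := Real.sqrt_le_sqrt hNx
  -- assemble
  have hmain : D ≤ C₁ * (exp 1 * √(θ / S) / S) * exp (1 - θ / S) := by
    have h1 : C₁ * (exp 1 * √((m : ℝ) + 1) / S) * (((m : ℝ) + 1) * S / (exp 1 * θ)) ^ (m + 1)
        ≤ C₁ * (exp 1 * √((m : ℝ) + 1) / S) * exp (1 - θ / S) :=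
      mul_le_mul_of_nonneg_left hgeom (by positivity)
    have h2 : C₁ * (exp 1 * √((m : ℝ) + 1) / S) * exp (1 - θ / S)
        ≤ C₁ * (exp 1 * √(θ / S) / S) * exp (1 - θ / S) := by
      have : exp 1 * √((m : ℝ) + 1) / S ≤ exp 1 * √(θ / S) / S := by
        rw [div_le_div_iff_of_pos_right hS]
        exact mul_le_mul_of_nonneg_left hsqrt (Real.exp_pos 1).le
      exact mul_le_mul_of_nonneg_right (mul_le_mul_of_nonneg_left this hC) (Real.exp_pos _).le
    calc D ≤ _ := hDm
      _ ≤ _ := hstep1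
      _ = _ := hrew
      _ ≤ _ := h1
      _ ≤ _ := h2
  -- convert to the `key_ineq` shape with x = θ/S
  have hkey := key_ineq (θ / S) hx1
  have hconv : C₁ * (exp 1 * √(θ / S) / S) * exp (1 - θ / S)
      = C₁ / θ * (exp 1 ^ 2 * (θ / S) * √(θ / S) * exp (-(θ / S))) := by
    have hS0 : S ≠ 0 := hS.ne'
    have hθ0 : θ ≠ 0 := hθ.ne'
    have hexp : exp (1 - θ / S) = exp 1 * exp (-(θ / S)) := by rw [← Real.exp_add]; ring_nf
    rw [hexp]
    field_simp
  have hfin : C₁ / θ * (exp 1 ^ 2 * (θ / S) * √(θ / S) * exp (-(θ / S))) ≤ C₁ / θ * (9 * exp (-(θ / S / 2))) :=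
    mul_le_mul_of_nonneg_left hkey (by positivity)
  have hlast : C₁ / θ * (9 * exp (-(θ / S / 2))) = 9 * C₁ / θ * exp (-(θ / (2 * S))) := by
    rw [div_div]; ring_nf
  calc D ≤ _ := hmain
    _ = _ := hconv
    _ ≤ _ := hfin
    _ = _ := hlast

/-- **S1 PROVED (was `stub_gevreyFlatness`).** An `S`-periodic smooth curve with Gevrey-1 bounds
`‖g⁽ⁿ⁾‖ ≤ C₁ n!/θⁿ` (`n ≥ 1`) and `0 < S ≤ θ` is super-exponentially flat: `‖g'‖ ≤ 9C₁θ⁻¹e^{−θ/(2S)}`. -/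
theorem gevreyFlatness_holds {g : ℝ → EuclideanSpace ℝ (Fin 3)} {S C₁ θ : ℝ} (hS : 0 < S) (hSθ : S ≤ θ)
    (hper : Function.Periodic g S) (hg : ∀ n : ℕ, ContDiff ℝ n g)
    (hb : ∀ n : ℕ, 1 ≤ n → ∀ s : ℝ, ‖iteratedDeriv n g s‖ ≤ C₁ * (n ! : ℝ) / θ ^ n) :
    ∀ s : ℝ, ‖deriv g s‖ ≤ 9 * C₁ / θ * Real.exp (-(θ / (2 * S))) := by
  have hθ : 0 < θ := lt_of_lt_of_le hS hSθ
  have hC : 0 ≤ C₁ := by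
    have h := (norm_nonneg _).trans (hb 1 le_rfl 0)
    rw [Nat.factorial_one, Nat.cast_one, mul_one, pow_one] at h
    exact (div_nonneg_iff.mp h).elim (fun h => h.1) (fun h => absurd h.2 (not_le.mpr hθ))
  -- periodicity and smoothness of all derivatives
  have hperk : ∀ k : ℕ, Function.Periodic (iteratedDeriv k g) S := by
    intro k x
    have h := congrFun (iteratedDeriv_comp_add_const (n := k) (f := g) (s := S)) x
    have hfun : (fun z => g (z + S)) = g := funext hper
    rw [hfun] at h
    exact h.symm
  have hgk : ∀ k : ℕ, ContDiff ℝ 2 (iteratedDeriv k g) := by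
    intro k
    rw [iteratedDeriv_eq_iterate]
    exact ContDiff.iterate_deriv' 2 k (hg (2 + k))
  have h2k : ∀ k : ℕ, ∀ s, iteratedDeriv 2 (iteratedDeriv k g) s = iteratedDeriv (k + 1 + 1) g s := by
    intro k s
    simp only [iteratedDeriv_eq_iterate]
    rw [← Function.iterate_add_apply, show 2 + k = k + 1 + 1 by ring]
  have h1k : ∀ k : ℕ, deriv (iteratedDeriv k g) = iteratedDeriv (k + 1) g := fun k =>
    (iteratedDeriv_succ (n := k) (f := g)).symm
  -- the iterated Poincaré bound: ‖g^{(k+1)}‖ ≤ S^{j+1} · C₁ (k+j+2)!/θ^{k+j+2}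
  have hQ : ∀ j k : ℕ, ∀ s, ‖iteratedDeriv (k + 1) g s‖ ≤
      S ^ (j + 1) * (C₁ * ((k + j + 2)! : ℝ) / θ ^ (k + j + 2)) := by
    intro j
    induction j with
    | zero =>
        intro k s
        have hP := periodic_deriv_norm_le hS (hperk k) (hgk k)
          (B := C₁ * ((k + 2)! : ℝ) / θ ^ (k + 2)) (fun σ => by rw [h2k k σ]; exact hb (k + 2) (by omega) σ) s
        rw [h1k k] at hP
        simpa [pow_one, mul_comm] using hP
    | succ j ih =>
        intro k s
        have hB : ∀ σ, ‖iteratedDeriv 2 (iteratedDeriv k g) σ‖ ≤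
            S ^ (j + 1) * (C₁ * ((k + 1 + j + 2)! : ℝ) / θ ^ (k + 1 + j + 2)) := fun σ => by
          rw [h2k k σ]; exact ih (k + 1) σ
        have hP := periodic_deriv_norm_le hS (hperk k) (hgk k) hB s
        rw [h1k k] at hP
        have e1 : k + 1 + j + 2 = k + (j + 1) + 2 := by ring
        rw [e1] at hP
        calc ‖iteratedDeriv (k + 1) g s‖ ≤ S ^ (j + 1) * (C₁ * ((k + (j + 1) + 2)! : ℝ) / θ ^ (k + (j + 1) + 2)) * S := hP
          _ = S ^ (j + 1 + 1) * (C₁ * ((k + (j + 1) + 2)! : ℝ) / θ ^ (k + (j + 1) + 2)) := by ring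
  intro s
  refine flat_optimise hC hS hSθ (fun m => ?_)
  cases m with
  | zero =>
      have h := hb 1 le_rfl s
      rw [iteratedDeriv_one] at h
      simpa using h
  | succ j =>
      have h := hQ j 0 s
      rw [zero_add, iteratedDeriv_one] at h
      calc ‖deriv g s‖ ≤ S ^ (j + 1) * (C₁ * ((0 + j + 2)! : ℝ) / θ ^ (0 + j + 2)) := h
        _ = C₁ * ((j + 1 + 1)! : ℝ) * S ^ (j + 1) / θ ^ (j + 1 + 1) := by
            simp only [zero_add, show j + 2 = j + 1 + 1 from rfl]; ring

end GevreyFlatness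

/-- **S2a object (v4): class-uniform real-analyticity jets at time `−1`.**  Every Type-I ancient mild solution of
the class `IsTypeIAncientMild C₀` has, at every point `(−1, x)`, joint space-time jets
`‖Dᵏ(uncurry u)(−1,x)‖ ≤ A·k!·τᵏ` (`A, τ` depending on `C₀` only; product norm on `ℝ × ℝ³`).  This is the
Literature-grade input (Lemarié-Rieusset 2016 Thm 9.12 in its complex-extension form, pp. 261–263: holomorphic
extension of a bounded Oseen-mild solution to `t₀ + Ω_{γ,M₀}`, `M₀ = (8C₂²‖u‖_∞)⁻²`, bound `2‖u(t₀)‖_∞`; Dong–Zhang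
2020 Prop 1 for the time variable; then Cauchy estimates) — the tree's typed versions
(`lemarieRieusset2016_local_analyticity`, `DongZhang2020_timeDerivative_bounds_boundedMild`) are qualitative /
`∃N`-after-`u`, so S2a is ONE re-filing with uniform constants (refuter briefing ns-afl-r1 g9, 15:32:10Z). -/
def SlabJets (C₀ A τ : ℝ) : Prop :=
  ∀ u : ℝ → EuclideanSpace ℝ (Fin 3) → EuclideanSpace ℝ (Fin 3), IsTypeIAncientMild C₀ u →
    ∀ (x : EuclideanSpace ℝ (Fin 3)) (k : ℕ),
      ‖iteratedFDeriv ℝ k (Function.uncurry u) ((-1 : ℝ), x)‖ ≤ A * (k ! : ℝ) * τ ^ k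

/-! #### The similarity curve through a label -/

/-- `σ ↦ (−e^{−σ}, e^{−σ/2} y)`. -/
def simCurve (y : EuclideanSpace ℝ (Fin 3)) : ℝ → ℝ × EuclideanSpace ℝ (Fin 3) :=
  fun σ => (-Real.exp (-σ), Real.exp (-σ / 2) • y)

theorem simCurve_zero (y : EuclideanSpace ℝ (Fin 3)) : simCurve y 0 = ((-1 : ℝ), y) := by
  simp [simCurve]

theorem simCurve_eq (y : EuclideanSpace ℝ (Fin 3)) :
    simCurve y = fun σ =>
      (ContinuousLinearMap.toSpanSingleton ℝ (((1 : ℝ), (0 : EuclideanSpace ℝ (Fin 3))) : ℝ × EuclideanSpace ℝ (Fin 3)))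
          (-Real.exp ((-1 : ℝ) * σ)) +
        (ContinuousLinearMap.toSpanSingleton ℝ (((0 : ℝ), y) : ℝ × EuclideanSpace ℝ (Fin 3)))
          (Real.exp ((-1 / 2 : ℝ) * σ)) := by
  funext σ
  simp only [simCurve, ContinuousLinearMap.toSpanSingleton_apply, Prod.smul_mk, smul_eq_mul, mul_one,
    smul_zero, mul_zero, Prod.mk_add_mk, add_zero, zero_add]
  rw [Prod.mk.injEq]
  constructor
  · ring_nf
  · congr 1; ring_nf

theorem contDiff_neg_exp : ContDiff ℝ (⊤ : ℕ∞) (fun σ : ℝ => -Real.exp ((-1 : ℝ) * σ)) :=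
  (Real.contDiff_exp.comp (contDiff_const.mul contDiff_id)).neg

theorem contDiff_exp_half : ContDiff ℝ (⊤ : ℕ∞) (fun σ : ℝ => Real.exp ((-1 / 2 : ℝ) * σ)) :=
  Real.contDiff_exp.comp (contDiff_const.mul contDiff_id)

theorem contDiff_simCurve (y : EuclideanSpace ℝ (Fin 3)) : ContDiff ℝ (⊤ : ℕ∞) (simCurve y) := by
  rw [simCurve_eq]
  exact ((ContinuousLinearMap.contDiff _).comp contDiff_neg_exp).add
    ((ContinuousLinearMap.contDiff _).comp contDiff_exp_half)

theorem norm_iteratedDeriv_neg_exp (i : ℕ) :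
    ‖iteratedDeriv i (fun σ : ℝ => -Real.exp ((-1 : ℝ) * σ)) 0‖ = 1 := by
  rw [iteratedDeriv_fun_neg, iteratedDeriv_exp_const_mul]
  simp

theorem norm_iteratedDeriv_exp_half (i : ℕ) :
    ‖iteratedDeriv i (fun σ : ℝ => Real.exp ((-1 / 2 : ℝ) * σ)) 0‖ ≤ 1 := by
  rw [iteratedDeriv_exp_const_mul]
  simp only [mul_zero, Real.exp_zero, mul_one, norm_pow, Real.norm_eq_abs]
  rw [abs_div, abs_neg, abs_one, abs_two]
  exact pow_le_one₀ (by norm_num) (by norm_num)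

/-- Jets of the similarity curve at `σ = 0`: `‖Dⁱγ_y(0)‖ ≤ 1 + ‖y‖`. -/
theorem norm_iteratedFDeriv_simCurve_zero_le (y : EuclideanSpace ℝ (Fin 3)) (i : ℕ) :
    ‖iteratedFDeriv ℝ i (simCurve y) 0‖ ≤ 1 + ‖y‖ := by
  rw [simCurve_eq]
  set L₁ := ContinuousLinearMap.toSpanSingleton ℝ (((1 : ℝ), (0 : EuclideanSpace ℝ (Fin 3))) : ℝ × EuclideanSpace ℝ (Fin 3))
  set L₂ := ContinuousLinearMap.toSpanSingleton ℝ (((0 : ℝ), y) : ℝ × EuclideanSpace ℝ (Fin 3))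
  have h1 : ContDiff ℝ (⊤ : ℕ∞) (fun σ => L₁ (-Real.exp ((-1 : ℝ) * σ))) := (L₁.contDiff).comp contDiff_neg_exp
  have h2 : ContDiff ℝ (⊤ : ℕ∞) (fun σ => L₂ (Real.exp ((-1 / 2 : ℝ) * σ))) := (L₂.contDiff).comp contDiff_exp_half
  rw [iteratedFDeriv_add_apply' (h1.of_le (by exact_mod_cast le_top)).contDiffAt (h2.of_le (by exact_mod_cast le_top)).contDiffAt]
  refine (norm_add_le _ _).trans ?_
  have e1 : iteratedFDeriv ℝ i (fun σ => L₁ (-Real.exp ((-1 : ℝ) * σ))) 0 =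
      L₁.compContinuousMultilinearMap (iteratedFDeriv ℝ i (fun σ : ℝ => -Real.exp ((-1 : ℝ) * σ)) 0) :=
    L₁.iteratedFDeriv_comp_left (contDiff_neg_exp.contDiffAt) (i := i) (by exact_mod_cast le_top)
  have e2 : iteratedFDeriv ℝ i (fun σ => L₂ (Real.exp ((-1 / 2 : ℝ) * σ))) 0 =
      L₂.compContinuousMultilinearMap (iteratedFDeriv ℝ i (fun σ : ℝ => Real.exp ((-1 / 2 : ℝ) * σ)) 0) :=
    L₂.iteratedFDeriv_comp_left (contDiff_exp_half.contDiffAt) (i := i) (by exact_mod_cast le_top)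
  rw [e1, e2]
  have n1 : ‖L₁‖ = 1 := by
    rw [ContinuousLinearMap.norm_toSpanSingleton]; simp [Prod.norm_def]
  have n2 : ‖L₂‖ = ‖y‖ := by
    rw [ContinuousLinearMap.norm_toSpanSingleton]; simp [Prod.norm_def]
  have b1 := L₁.norm_compContinuousMultilinearMap_le (iteratedFDeriv ℝ i (fun σ : ℝ => -Real.exp ((-1 : ℝ) * σ)) 0)
  have b2 := L₂.norm_compContinuousMultilinearMap_le (iteratedFDeriv ℝ i (fun σ : ℝ => Real.exp ((-1 / 2 : ℝ) * σ)) 0)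
  rw [n1, norm_iteratedFDeriv_eq_norm_iteratedDeriv, norm_iteratedDeriv_neg_exp] at b1
  rw [n2, norm_iteratedFDeriv_eq_norm_iteratedDeriv] at b2
  have b2' : ‖L₂.compContinuousMultilinearMap (iteratedFDeriv ℝ i (fun σ : ℝ => Real.exp ((-1 / 2 : ℝ) * σ)) 0)‖ ≤ ‖y‖ :=
    b2.trans (by nlinarith [norm_nonneg y, norm_iteratedDeriv_exp_half i,
      norm_nonneg (iteratedDeriv i (fun σ : ℝ => Real.exp ((-1 / 2 : ℝ) * σ)) 0)])
  linarith

/-! #### A combinatorial estimate -/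

theorem comb_sum_le {A τ₁ : ℝ} (hA : 0 ≤ A) (hτ₁ : 2 ≤ τ₁) (n : ℕ) :
    ∑ i ∈ Finset.range (n + 1), (n.choose i : ℝ) * 1 * (A * ((n - i) ! : ℝ) * τ₁ ^ (n - i)) ≤
      2 * A * (n ! : ℝ) * τ₁ ^ n := by
  have hτ0 : 0 ≤ τ₁ := by linarith
  have hterm : ∀ i ∈ Finset.range (n + 1),
      (n.choose i : ℝ) * 1 * (A * ((n - i) ! : ℝ) * τ₁ ^ (n - i)) ≤ A * (n ! : ℝ) * τ₁ ^ n * (1 / 2 : ℝ) ^ i := by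
    intro i hi
    have hin : i ≤ n := Nat.lt_succ_iff.1 (Finset.mem_range.1 hi)
    have hcf : (n.choose i : ℝ) * ((n - i) ! : ℝ) ≤ (n ! : ℝ) := by
      have h := Nat.choose_mul_factorial_mul_factorial hin
      have h' : n.choose i * (n - i)! ≤ n ! := by
        calc n.choose i * (n - i)! ≤ n.choose i * (n - i)! * i ! :=
              Nat.le_mul_of_pos_right _ (Nat.factorial_pos i)
          _ = n ! := by rw [← h]; ring
      exact_mod_cast h'
    have hpow : τ₁ ^ (n - i) ≤ τ₁ ^ n * (1 / 2 : ℝ) ^ i := by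
      rw [one_div, inv_pow, ← div_eq_mul_inv, le_div_iff₀ (by positivity)]
      calc τ₁ ^ (n - i) * 2 ^ i ≤ τ₁ ^ (n - i) * τ₁ ^ i := by gcongr
        _ = τ₁ ^ n := by rw [← pow_add, Nat.sub_add_cancel hin]
    calc (n.choose i : ℝ) * 1 * (A * ((n - i) ! : ℝ) * τ₁ ^ (n - i))
        = A * ((n.choose i : ℝ) * ((n - i) ! : ℝ)) * τ₁ ^ (n - i) := by ring
      _ ≤ A * (n ! : ℝ) * (τ₁ ^ n * (1 / 2 : ℝ) ^ i) := by gcongr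
      _ = A * (n ! : ℝ) * τ₁ ^ n * (1 / 2 : ℝ) ^ i := by ring
  calc ∑ i ∈ Finset.range (n + 1), (n.choose i : ℝ) * 1 * (A * ((n - i) ! : ℝ) * τ₁ ^ (n - i))
      ≤ ∑ i ∈ Finset.range (n + 1), A * (n ! : ℝ) * τ₁ ^ n * (1 / 2 : ℝ) ^ i := Finset.sum_le_sum hterm
    _ = A * (n ! : ℝ) * τ₁ ^ n * ∑ i ∈ Finset.range (n + 1), (1 / 2 : ℝ) ^ i := by rw [Finset.mul_sum]
    _ ≤ A * (n ! : ℝ) * τ₁ ^ n * 2 := by gcongr; exact sum_geometric_two_le _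
    _ = 2 * A * (n ! : ℝ) * τ₁ ^ n := by ring

/-! #### The cut-off extension of `uncurry u` -/

/-- smooth time cut-off: `= 1` for `t ≤ −1/2`, `= 0` for `t ≥ −1/3`. -/
def timeCut (t : ℝ) : ℝ := Real.smoothTransition (-6 * t - 2)

theorem timeCut_of_le {t : ℝ} (ht : t ≤ -1 / 2) : timeCut t = 1 :=
  Real.smoothTransition.one_of_one_le (by linarith)

theorem timeCut_of_ge {t : ℝ} (ht : -1 / 3 ≤ t) : timeCut t = 0 :=
  Real.smoothTransition.zero_of_nonpos (by linarith)

theorem contDiff_timeCut : ContDiff ℝ (⊤ : ℕ∞) timeCut :=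
  Real.smoothTransition.contDiff.comp ((contDiff_const.mul contDiff_id).sub contDiff_const)

/-- `g(t,x) = χ(t) u(t,x)` is globally smooth when `u` is smooth on the open past. -/
theorem contDiff_cutExt {u : ℝ → EuclideanSpace ℝ (Fin 3) → EuclideanSpace ℝ (Fin 3)}
    (hu : ContDiffOn ℝ (⊤ : ℕ∞) (uncurry u) (Iio 0 ×ˢ univ)) :
    ContDiff ℝ (⊤ : ℕ∞) (fun z : ℝ × EuclideanSpace ℝ (Fin 3) => timeCut z.1 • uncurry u z) := by
  rw [contDiff_iff_contDiffAt]
  intro z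
  by_cases hz : z.1 < 0
  · have h1 : ContDiffAt ℝ (⊤ : ℕ∞) (uncurry u) z :=
      hu.contDiffAt ((isOpen_Iio.prod isOpen_univ).mem_nhds ⟨hz, mem_univ _⟩)
    have h2 : ContDiffAt ℝ (⊤ : ℕ∞) (fun z : ℝ × EuclideanSpace ℝ (Fin 3) => timeCut z.1) z :=
      (contDiff_timeCut.comp contDiff_fst).contDiffAt
    exact h2.smul h1
  · push_neg at hz
    have hev : (fun z : ℝ × EuclideanSpace ℝ (Fin 3) => timeCut z.1 • uncurry u z) =ᶠ[𝓝 z]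
        fun _ => (0 : EuclideanSpace ℝ (Fin 3)) := by
      have ho : IsOpen {z' : ℝ × EuclideanSpace ℝ (Fin 3) | -1 / 3 < z'.1} := isOpen_lt continuous_const continuous_fst
      filter_upwards [ho.mem_nhds (show -1 / 3 < z.1 by linarith)] with z' hz'
      rw [timeCut_of_ge (le_of_lt hz'), zero_smul]
    exact contDiffAt_const.congr_of_eventuallyEq hev

theorem cutExt_eventuallyEq {u : ℝ → EuclideanSpace ℝ (Fin 3) → EuclideanSpace ℝ (Fin 3)}
    (x : EuclideanSpace ℝ (Fin 3)) :
    (fun z : ℝ × EuclideanSpace ℝ (Fin 3) => timeCut z.1 • uncurry u z) =ᶠ[𝓝 ((-1 : ℝ), x)] uncurry u := by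
  have ho : IsOpen {z' : ℝ × EuclideanSpace ℝ (Fin 3) | z'.1 < -1 / 2} := isOpen_lt continuous_fst continuous_const
  filter_upwards [ho.mem_nhds (show ((-1 : ℝ), x).1 < -1 / 2 by norm_num)] with z' hz'
  rw [timeCut_of_le (le_of_lt hz'), one_smul]

/-! #### S2b, step 1: jets of the profile line at `σ = 0` -/

theorem jets_at_zero {C₀ A τ R : ℝ} (hA : 0 ≤ A) (hτ : 0 ≤ τ) (hR : 0 ≤ R) (hJ : SlabJets C₀ A τ)
    {v : ℝ → EuclideanSpace ℝ (Fin 3) → EuclideanSpace ℝ (Fin 3)} (hv : IsTypeIAncientMild C₀ v)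
    {y : EuclideanSpace ℝ (Fin 3)} (hy : ‖y‖ ≤ R) (n : ℕ) :
    ‖iteratedDeriv n (profileLine v y) 0‖ ≤ 2 * A * (n ! : ℝ) * (4 * (1 + τ * (1 + R))) ^ n := by
  set g : ℝ × EuclideanSpace ℝ (Fin 3) → EuclideanSpace ℝ (Fin 3) := fun z => timeCut z.1 • uncurry v z with hgdef
  have hg : ContDiff ℝ (⊤ : ℕ∞) g := contDiff_cutExt hv.contDiffOn
  have hjet : ∀ k, ‖iteratedFDeriv ℝ k g (simCurve y 0)‖ ≤ A * (k ! : ℝ) * τ ^ k := by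
    intro k
    rw [simCurve_zero, ((cutExt_eventuallyEq (u := v) y).iteratedFDeriv (𝕜 := ℝ) k).eq_of_nhds]
    exact hJ v hv y k
  -- composition with the similarity curve
  have hcomp : ∀ m, ‖iteratedFDeriv ℝ m (g ∘ simCurve y) 0‖ ≤ A * (m ! : ℝ) * (4 * (1 + τ * (1 + R))) ^ m := by
    intro m
    have h := norm_iteratedFDeriv_comp_le_of_factorial (contDiff_simCurve y) 0 (B := 1 + R) (σ := 1) (τ := τ)
      (by positivity) zero_le_one hτ m
      (fun i hi _ => by
        rw [one_pow, mul_one]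
        calc ‖iteratedFDeriv ℝ i (simCurve y) 0‖ ≤ 1 + ‖y‖ := norm_iteratedFDeriv_simCurve_zero_le y i
          _ ≤ (1 + R) * 1 := by linarith
          _ ≤ (1 + R) * (i ! : ℝ) := by gcongr; exact_mod_cast Nat.one_le_iff_ne_zero.2 (Nat.factorial_ne_zero i))
      hg A 0 (fun k _ => by simpa using hjet k)
    simpa using h
  -- the weight `e^{−σ/2}` and the local identity with the profile line
  have heq : profileLine v y =ᶠ[𝓝 0] fun σ => Real.exp ((-1 / 2 : ℝ) * σ) • (g ∘ simCurve y) σ := by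
    have hlog : (0 : ℝ) < Real.log 2 := Real.log_pos one_lt_two
    filter_upwards [Iio_mem_nhds hlog] with σ hσ
    have hexp : 1 / 2 < Real.exp (-σ) := by
      have : Real.exp (-Real.log 2) = 1 / 2 := by rw [Real.exp_neg, Real.exp_log two_pos]; norm_num
      rw [← this]; exact Real.exp_lt_exp.2 (by linarith [mem_Iio.1 hσ])
    have hcut : timeCut (-Real.exp (-σ)) = 1 := timeCut_of_le (by linarith)
    simp only [profileLine, lerayOrbit_apply, comp_apply, simCurve, hgdef, uncurry_apply_pair, hcut, one_smul]
    congr 1; ring_nf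
  rw [heq.iteratedDeriv_eq n, ← norm_iteratedFDeriv_eq_norm_iteratedDeriv]
  have hφ : ContDiff ℝ (⊤ : ℕ∞) (fun σ : ℝ => Real.exp ((-1 / 2 : ℝ) * σ)) := contDiff_exp_half
  have hh : ContDiff ℝ (⊤ : ℕ∞) (g ∘ simCurve y) := hg.comp (contDiff_simCurve y)
  refine (norm_iteratedFDeriv_smul_le hφ hh 0 (n := n) (by exact_mod_cast le_top)).trans ?_
  have hτ₁ : 2 ≤ 4 * (1 + τ * (1 + R)) := by nlinarith [mul_nonneg hτ (by linarith : (0:ℝ) ≤ 1 + R)]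
  refine le_trans (Finset.sum_le_sum fun i hi => ?_) (comb_sum_le hA hτ₁ n)
  have a1 : ‖iteratedFDeriv ℝ i (fun σ : ℝ => Real.exp ((-1 / 2 : ℝ) * σ)) 0‖ ≤ 1 := by
    rw [norm_iteratedFDeriv_eq_norm_iteratedDeriv]; exact norm_iteratedDeriv_exp_half i
  have a2 := hcomp (n - i)
  gcongr

/-! #### S2b, step 2: scaling covariance makes the constants uniform in `s` -/

theorem contDiff_profileLine_of_mild {C₀ : ℝ} {u : ℝ → EuclideanSpace ℝ (Fin 3) → EuclideanSpace ℝ (Fin 3)}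
    (hu : IsTypeIAncientMild C₀ u) (y : EuclideanSpace ℝ (Fin 3)) (n : ℕ) : ContDiff ℝ n (profileLine u y) := by
  have h := (contDiff_uncurry_lerayOrbit hu.contDiffOn).comp (contDiff_id.prodMk contDiff_const : ContDiff ℝ (⊤ : ℕ∞) fun s : ℝ => (s, y))
  exact h.of_le (by exact_mod_cast le_top)

theorem profileGevreyBoundMild_of_slabJets {C₀ A τ R : ℝ} (hA : 0 ≤ A) (hτ : 0 ≤ τ) (hR : 0 ≤ R)
    (hJ : SlabJets C₀ A τ) :
    ProfileGevreyBoundMild C₀ R (max 1 (2 * A)) (1 / (4 * (1 + τ * (1 + R)))) := by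
  intro u hu y hy
  refine ⟨fun n => contDiff_profileLine_of_mild hu y n, fun n _ s => ?_⟩
  set c : ℝ := Real.exp (-s / 2) with hcdef
  have hc : 0 < c := Real.exp_pos _
  have hv : IsTypeIAncientMild C₀ (FluidPDE.nsRescale c u) := hu.nsRescale hc
  have hshift : profileLine u y = fun σ => profileLine (FluidPDE.nsRescale c u) y (σ - s) := by
    funext σ
    simp only [profileLine]
    rw [lerayOrbit_nsRescale hc, hcdef, Real.log_exp]
    congr 1; ring
  rw [hshift, iteratedDeriv_comp_sub_const]
  simp only [sub_self]
  have hj := jets_at_zero hA hτ hR hJ hv hy n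
  have hτ₁ : 0 < 4 * (1 + τ * (1 + R)) := by nlinarith [mul_nonneg hτ (by linarith : (0:ℝ) ≤ 1 + R)]
  rw [one_div, inv_pow, div_eq_mul_inv, inv_inv]
  calc ‖iteratedDeriv n (profileLine (FluidPDE.nsRescale c u) y) 0‖
      ≤ 2 * A * (n ! : ℝ) * (4 * (1 + τ * (1 + R))) ^ n := hj
    _ ≤ max 1 (2 * A) * (n ! : ℝ) * (4 * (1 + τ * (1 + R))) ^ n := by gcongr; exact le_max_right _ _


/-- **Stub S2a (v4) — the ONLY `sorry` of the line.**  For every `C₀ > 0` there are `A, τ > 0` with `SlabJets C₀ A τ`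
(class-uniform real-analyticity jets of Type-I ancient mild solutions at time `−1`; by scaling, at all times). -/
theorem stub_slabJets : ∀ C₀ : ℝ, 0 < C₀ → ∃ A τ : ℝ, 0 < A ∧ 0 < τ ∧ SlabJets C₀ A τ := by
  sorry

/-- **S2′ (v3's stub) is now DERIVED (v4): S2a `stub_slabJets` + the PROVED S2b `profileGevreyBoundMild_of_slabJets`**
(cut-off extension `contDiff_cutExt`, Faà di Bruno along the similarity curve `norm_iteratedFDeriv_comp_le_of_factorial`,
Leibniz with the weight `e^{−σ/2}`, `comb_sum_le`, and scaling covariance `lerayOrbit_nsRescale` +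
`IsTypeIAncientMild.nsRescale`), with `C₁ = max 1 (2A)` and `θ = 1/(4(1 + τ(1 + R)))`. -/
theorem profileGevreyBoundMild_exists :
    ∀ C₀ : ℝ, 0 < C₀ → ∀ R : ℝ, 0 < R → ∃ C₁ θ : ℝ, 1 ≤ C₁ ∧ 0 < θ ∧ θ ≤ 1 ∧ ProfileGevreyBoundMild C₀ R C₁ θ := by
  intro C₀ hC₀ R hR
  obtain ⟨A, τ, hA, hτ, hJ⟩ := stub_slabJets C₀ hC₀
  have hτ₁ : 1 ≤ 4 * (1 + τ * (1 + R)) := by nlinarith [mul_nonneg hτ.le (by linarith : (0:ℝ) ≤ 1 + R)]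
  refine ⟨max 1 (2 * A), 1 / (4 * (1 + τ * (1 + R))), le_max_left _ _, by positivity, ?_,
    profileGevreyBoundMild_of_slabJets hA.le hτ.le hR.le hJ⟩
  rw [div_le_one (by positivity)]
  exact hτ₁

/-- The v1/v2 statement of S2 (envelope class), now DERIVED from the mild stub and the tree's KNSS mildness. -/
theorem profileGevreyBound_exists :
    ∀ C₀ : ℝ, 0 < C₀ → ∀ R : ℝ, 0 < R → ∃ C₁ θ : ℝ, 1 ≤ C₁ ∧ 0 < θ ∧ θ ≤ 1 ∧ ProfileGevreyBound C₀ R C₁ θ := by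
  intro C₀ hC₀ R hR
  obtain ⟨C₁, θ, hC₁, hθ, hθ1, h⟩ := profileGevreyBoundMild_exists C₀ hC₀ R hR
  exact ⟨C₁, θ, hC₁, hθ, hθ1, profileGevreyBound_of_mild h⟩

/-- **P3, the provable half of the instrument row.** At the acceleration constant certified by the SAME
Gevrey data, `B_G = 2C₁/θ²` (`accel_of_gevrey`), the analytic log-window dominates the tree-shaped linear
window: `δ₀/(2B_G) ≤ θ/(4 log(9C₁/(θδ₀)))` as soon as `9C₁/(θδ₀) ≥ 32` — in particular whenever
`δ₀ ≤ 9/32`, since `C₁/θ ≥ 1`.  (Against the tree's OPTIMAL `B` the comparison `θB ≥ 2δ₀ log(9C₁/(θδ₀))`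
is undecided: no constant is pinned in tree or print.) -/
theorem window_comparison {δ₀ θ C₁ : ℝ} (hδ₀ : 0 < δ₀) (hθ : 0 < θ) (hC₁ : 1 ≤ C₁)
    (hz : 32 ≤ 9 * C₁ / (θ * δ₀)) :
    δ₀ / (2 * (2 * C₁ / θ ^ 2)) ≤ θ / (4 * Real.log (9 * C₁ / (θ * δ₀))) := by
  set z : ℝ := 9 * C₁ / (θ * δ₀) with hzdef
  have hz0 : 0 < z := by positivity
  have hC0 : 0 < C₁ := by linarith
  -- `log z ≤ z/9` for `z ≥ 32`
  have hlog2 : Real.log 2 < 0.6931471808 := Real.log_two_lt_d9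
  have hlog32 : Real.log 32 = 5 * Real.log 2 := by
    rw [show (32 : ℝ) = 2 ^ 5 by norm_num, Real.log_pow]; norm_num
  have hL : Real.log z ≤ z / 9 := by
    have h1 : Real.log z = Real.log 32 + Real.log (z / 32) := by
      rw [← Real.log_mul (by norm_num) (by positivity)]; congr 1; field_simp
    have h2 : Real.log (z / 32) ≤ z / 32 - 1 := Real.log_le_sub_one_of_pos (by positivity)
    rw [h1, hlog32]; nlinarith
  have hLpos : 0 < Real.log z := Real.log_pos (by linarith)
  -- algebra: `δ₀θ²/(4C₁) ≤ θ/(4 log z)` iff `δ₀ θ log z ≤ C₁`, and `δ₀ θ (z/9) = C₁`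
  have hkey : δ₀ * θ * Real.log z ≤ C₁ := by
    have : δ₀ * θ * (z / 9) = C₁ := by rw [hzdef]; field_simp
    nlinarith [mul_pos hδ₀ hθ]
  have hr : θ * (2 * (2 * C₁ / θ ^ 2)) = 4 * C₁ / θ := by field_simp; ring
  rw [div_le_div_iff₀ (by positivity) (by positivity), hr, le_div_iff₀ hθ]
  nlinarith [hkey]

/-! ### Proved: bookkeeping around Pineau–Vicol's threshold -/

/-- The tree's one-slice threshold, with the slice parameter `s₀` exposed. -/
theorem oneSliceThresholdAt_of {Cu δ₀ Cp : ℝ} (hT : OneSliceThreshold Cu δ₀) (hCp : 0 < Cp) :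
    ∃ s₀ : ℝ, 1 ≤ s₀ ∧ OneSliceThresholdAt Cu δ₀ Cp s₀ := by
  obtain ⟨s₀, hs₀, h⟩ := hT.2 Cp hCp
  exact ⟨s₀, hs₀, fun u p hreg henv hpb tbar h1 h2 hflat => h u p hreg henv hpb tbar h1 h2 hflat⟩

/-- A smaller threshold is still a threshold. -/
theorem OneSliceThresholdAt.mono {Cu δ₀ δ₀' Cp s₀ : ℝ} (h : OneSliceThresholdAt Cu δ₀ Cp s₀) (hle : δ₀' ≤ δ₀) :
    OneSliceThresholdAt Cu δ₀' Cp s₀ :=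
  fun u p hreg henv hpb tbar h1 h2 hflat => h u p hreg henv hpb tbar h1 h2 fun x hx => (hflat x hx).trans hle

/-! ### Proved: the compositions -/

/-- **Regular apex from flatness ON THE INSPECTED BALL ONLY.** If the profile lines with labels
`‖y‖ ≤ 2e^{s₀/2}` are `δ₀`-flat at all times, the apex is regular: the slice `t̄ = −e^{−s₀}/4` of Thm 1.9
inspects exactly the labels `y = x/√(−t̄) = 2e^{s₀/2}x`, `‖x‖ < 1`. -/
theorem regularApex_of_flatOnBall (hdict : SliceDictionary) {C₀ δ₀ Cp s₀ : ℝ}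
    (hT : OneSliceThresholdAt C₀ δ₀ Cp s₀) (hs₀ : 1 ≤ s₀)
    {u : ℝ → EuclideanSpace ℝ (Fin 3) → EuclideanSpace ℝ (Fin 3)} {p p' : ℝ → EuclideanSpace ℝ (Fin 3) → ℝ}
    (hsol : IsClassicalNSSolutionOn (Iio 0) 1 0 u p) (hdec : HasTypeIDecay C₀ u)
    (hreg : IsClassicalNSSolutionOnRegion pvRegion 1 0 u p')
    (hpb : ∀ t ∈ Ico (-1 : ℝ) 0, ∀ x : EuclideanSpace ℝ (Fin 3), 1 / 2 < ‖x‖ → ‖x‖ < 3 / 4 → |p' t x| ≤ Cp)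
    (hflat : ∀ (s : ℝ) (y : EuclideanSpace ℝ (Fin 3)), ‖y‖ ≤ 2 * Real.exp (s₀ / 2) →
      ‖deriv (profileLine u y) s‖ ≤ δ₀) :
    ∃ r : ℝ, 0 < r ∧ ∃ M : ℝ, ∀ t : ℝ, -r ^ 2 < t → t < 0 →
      ∀ x ∈ ball (0 : EuclideanSpace ℝ (Fin 3)) r, ‖u t x‖ ≤ M := by
  have henv : ∀ t ∈ Ico (-1 : ℝ) 0, ∀ x ∈ ball (0 : EuclideanSpace ℝ (Fin 3)) 1,
      ‖u t x‖ ≤ C₀ / (Real.sqrt (-t) + ‖x‖) := by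
    intro t ht x _
    rw [add_comm]
    exact hdec t ht.2 x
  -- the slice `t̄ = −e^{−s₀}/4`
  set tbar : ℝ := -Real.exp (-s₀) / 4 with htbar
  have hpos : 0 < Real.exp (-s₀) := Real.exp_pos _
  have h1 : -Real.exp (-s₀) < tbar := by rw [htbar]; linarith
  have h2 : tbar < 0 := by rw [htbar]; linarith
  have h3 : -1 < tbar := by
    have : Real.exp (-s₀) ≤ 1 := by rw [Real.exp_le_one_iff]; linarith
    linarith
  -- `√(−t̄) = e^{−s₀/2}/2`, so `1/√(−t̄) = 2 e^{s₀/2}`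
  have hsq : Real.sqrt (-tbar) = Real.exp (-s₀ / 2) / 2 := by
    have hnn : 0 ≤ Real.exp (-s₀ / 2) / 2 := by positivity
    have : -tbar = (Real.exp (-s₀ / 2) / 2) ^ 2 := by
      rw [htbar, div_pow, ← Real.exp_nat_mul]
      ring_nf
    rw [this, Real.sqrt_sq hnn]
  have hinv : (Real.sqrt (-tbar))⁻¹ = 2 * Real.exp (s₀ / 2) := by
    have hmul : Real.exp (-s₀ / 2) * Real.exp (s₀ / 2) = 1 := by
      rw [← Real.exp_add]
      have : -s₀ / 2 + s₀ / 2 = 0 := by ring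
      rw [this, Real.exp_zero]
    rw [hsq, inv_div, div_eq_iff (Real.exp_pos _).ne']
    linear_combination (-2) * hmul
  refine hT u p' hreg henv hpb tbar h1 h2 fun x hx => ?_
  rw [hdict u p hsol tbar h3 h2 x hx]
  apply hflat
  rw [norm_smul, hinv, Real.norm_eq_abs, abs_of_pos (by positivity)]
  have hx1 : ‖x‖ < 1 := by simpa using hx
  have h2e : 0 < 2 * Real.exp (s₀ / 2) := by positivity
  nlinarith [norm_nonneg x]

/-- **The window arithmetic.** With `C₁ ≥ 1`, `θ, δ₀ ∈ (0,1]` and `0 < S ≤ θ/(2 log(9C₁/(θδ₀)))`: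
`S ≤ θ` and `9C₁θ⁻¹e^{−θ/(2S)} ≤ δ₀`. -/
theorem window_arith {C₁ θ δ₀ S : ℝ} (hC₁ : 1 ≤ C₁) (hθ : 0 < θ) (hθ1 : θ ≤ 1) (hδ₀ : 0 < δ₀)
    (hδ₁ : δ₀ ≤ 1) (hS : 0 < S) (hwin : S ≤ θ / (2 * Real.log (9 * C₁ / (θ * δ₀)))) :
    S ≤ θ ∧ 9 * C₁ / θ * Real.exp (-(θ / (2 * S))) ≤ δ₀ := by
  have hC₁pos : 0 < C₁ := by linarith
  have hθ0 : θ ≠ 0 := hθ.ne'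
  have hC0 : C₁ ≠ 0 := hC₁pos.ne'
  have hθδ : 0 < θ * δ₀ := mul_pos hθ hδ₀
  have hθδ1 : θ * δ₀ ≤ 1 := by
    calc θ * δ₀ ≤ 1 * 1 := mul_le_mul hθ1 hδ₁ hδ₀.le zero_le_one
      _ = 1 := by ring
  have hQpos : 0 < 9 * C₁ / (θ * δ₀) := by positivity
  have hQ9 : 9 ≤ 9 * C₁ / (θ * δ₀) := by
    rw [le_div_iff₀ hθδ]
    have := mul_le_mul_of_nonneg_left (hθδ1.trans hC₁) (by norm_num : (0 : ℝ) ≤ 9)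
    linarith
  have hL1 : 1 ≤ Real.log (9 * C₁ / (θ * δ₀)) := by
    have he : Real.exp 1 ≤ 9 * C₁ / (θ * δ₀) := by
      have h9 : Real.exp 1 ≤ 9 := by
        have := Real.exp_one_lt_d9
        linarith
      exact h9.trans hQ9
    have := Real.log_le_log (Real.exp_pos 1) he
    rwa [Real.log_exp] at this
  have hEL : Real.exp (-Real.log (9 * C₁ / (θ * δ₀))) = θ * δ₀ / (9 * C₁) := by
    rw [Real.exp_neg, Real.exp_log hQpos, inv_div]
  generalize Real.log (9 * C₁ / (θ * δ₀)) = L at hwin hL1 hEL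
  have hLpos : 0 < L := by linarith
  constructor
  · have : θ / (2 * L) ≤ θ := by
      rw [div_le_iff₀ (by positivity)]
      nlinarith
    exact hwin.trans this
  · have h1 : L ≤ θ / (2 * S) := by
      rw [le_div_iff₀ (by positivity)]
      have h := mul_le_mul_of_nonneg_left hwin (by positivity : (0 : ℝ) ≤ 2 * L)
      have h' : 2 * L * (θ / (2 * L)) = θ := by field_simp
      calc L * (2 * S) = 2 * L * S := by ring
        _ ≤ 2 * L * (θ / (2 * L)) := h
        _ = θ := h'
    have h2 : Real.exp (-(θ / (2 * S))) ≤ θ * δ₀ / (9 * C₁) := by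
      rw [← hEL]
      exact Real.exp_le_exp.mpr (by linarith)
    calc 9 * C₁ / θ * Real.exp (-(θ / (2 * S))) ≤ 9 * C₁ / θ * (θ * δ₀ / (9 * C₁)) :=
          mul_le_mul_of_nonneg_left h2 (by positivity)
      _ = δ₀ := by field_simp

/-- **Flatness on the inspected ball inside the analytic window.** If the profile lines on `‖y‖ ≤ R` are
Gevrey-1 (`C₁ ≥ 1`, `0 < θ ≤ 1`), `0 < δ₀ ≤ 1`, and the period `S = 2 log λ` satisfies
`S ≤ θ/(2 log(9C₁/(θδ₀)))`, then every such line of a `λ`-DSS solution is `δ₀`-flat. -/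
theorem flatOnBall_of_window {C₀ R C₁ θ δ₀ c : ℝ} (hG : ProfileGevreyBound C₀ R C₁ θ)
    (hC₁ : 1 ≤ C₁) (hθ : 0 < θ) (hθ1 : θ ≤ 1) (hδ₀ : 0 < δ₀) (hδ₁ : δ₀ ≤ 1) (hc : 1 < c)
    (hwin : 2 * Real.log c ≤ θ / (2 * Real.log (9 * C₁ / (θ * δ₀))))
    {u : ℝ → EuclideanSpace ℝ (Fin 3) → EuclideanSpace ℝ (Fin 3)} {p : ℝ → EuclideanSpace ℝ (Fin 3) → ℝ}
    (hsol : IsClassicalNSSolutionOn (Iio 0) 1 0 u p) (hdss : IsDiscretelySelfSimilar c u)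
    (hdec : HasTypeIDecay C₀ u) :
    ∀ (s : ℝ) (y : EuclideanSpace ℝ (Fin 3)), ‖y‖ ≤ R → ‖deriv (profileLine u y) s‖ ≤ δ₀ := by
  intro s y hy
  have hc0 : 0 < c := lt_trans zero_lt_one hc
  have hS : 0 < 2 * Real.log c := by have := Real.log_pos hc; linarith
  obtain ⟨hSθ, hδ⟩ := window_arith hC₁ hθ hθ1 hδ₀ hδ₁ hS hwin
  -- periodicity and the Gevrey bound of the line
  obtain ⟨hCk, hgev⟩ := hG u p hsol hdec y hy
  have hper : Function.Periodic (profileLine u y) (2 * Real.log c) := by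
    intro σ
    have := hdss.periodic_lerayOrbit hc0 σ
    simpa [profileLine] using congrFun this y
  exact (gevreyFlatness_holds hS hSθ hper hCk hgev s).trans hδ

/-- **The analytic window theorem from the obligations.** One-slice threshold `δ₀ ≤ 1` at slice parameter
`s₀`, annulus pressure, dictionary, and Gevrey-1 profile lines on the inspected ball `‖y‖ ≤ 2e^{s₀/2}` give:
every `λ`-DSS envelope-class (`C₀`) classical ancient solution with `2 log λ ≤ θ/(2 log(9C₁/(θδ₀)))` is zero. -/
theorem removingDss_analyticWindow_of (hdict : SliceDictionary) {C₀ δ₀ Cp s₀ C₁ θ : ℝ}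
    (hT : OneSliceThresholdAt C₀ δ₀ Cp s₀) (hs₀ : 1 ≤ s₀) (hδ₀ : 0 < δ₀) (hδ₁ : δ₀ ≤ 1)
    (hP : AnnulusPressure C₀ Cp) (hG : ProfileGevreyBound C₀ (2 * Real.exp (s₀ / 2)) C₁ θ)
    (hC₁ : 1 ≤ C₁) (hθ : 0 < θ) (hθ1 : θ ≤ 1) :
    ∀ c : ℝ, 1 < c → 2 * Real.log c ≤ θ / (2 * Real.log (9 * C₁ / (θ * δ₀))) →
      ∀ (u : ℝ → EuclideanSpace ℝ (Fin 3) → EuclideanSpace ℝ (Fin 3)) (p : ℝ → EuclideanSpace ℝ (Fin 3) → ℝ),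
        IsClassicalNSSolutionOn (Iio 0) 1 0 u p → IsDiscretelySelfSimilar c u → HasTypeIDecay C₀ u →
        ∀ t < 0, ∀ x, u t x = 0 := by
  intro c hc hwin u p hsol hdss hdec
  obtain ⟨p', hreg, hpb⟩ := hP u p hsol hdec
  have hflat := flatOnBall_of_window hG hC₁ hθ hθ1 hδ₀ hδ₁ hc hwin hsol hdss hdec
  obtain ⟨r, hr, M, hM⟩ := regularApex_of_flatOnBall hdict hT hs₀ hsol hdec hreg hpb hflat
  exact eq_zero_of_dss_of_bounded_apex hc hdss hr hM

/-- **RUNG of the line (v3, critic P1): the displayed ANALYTIC window, for ALL admissible data.**  For every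
envelope constant `C₀`, every one-slice threshold datum `(δ₀, Cp, s₀)` (Pineau–Vicol Thm 1.9: `OneSliceThresholdAt`,
annulus pressure `AnnulusPressure`), and every Gevrey-1 datum `(C₁, θ)` of the profile lines on the inspected ball
`‖y‖ ≤ 2e^{s₀/2}` (`ProfileGevreyBound`), every `λ`-DSS classical ancient solution of the class `HasTypeIDecay C₀` with

  `1 < λ ≤ exp( θ / (4 log(9 C₁/(θ δ₀))) )`

vanishes identically.  SORRY-FREE (it uses S1 `gevreyFlatness_holds`, the tree dictionary `stub_sliceDictionary`
p629490 and the tree apex/Liouville steps; it does NOT use S2 — S2 `stub_profileGevreyBoundMild` is what makes the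
Gevrey hypothesis dischargeable for every `C₀, R`, see `analyticWindow_rung_exists`).  The window is LOGARITHMIC in
`δ₀` at fixed Gevrey data, versus the tree's `exp(δ₀/(2B))` (`removingDss_explicitWindow`, p633176), linear at
fixed `B`; `window_comparison` is the provable half of that comparison.  This does NOT conclude the crux
`TypeIQuantSubcubicExp` (24077), narrows no open stub of `thin_cascade` (S3 = every `λ > 1`), and proves no summit. -/
theorem analyticWindow_rung {C₀ δ₀ Cp s₀ C₁ θ : ℝ}
    (hT : OneSliceThresholdAt C₀ δ₀ Cp s₀) (hs₀ : 1 ≤ s₀) (hδ₀ : 0 < δ₀) (hδ₁ : δ₀ ≤ 1)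
    (hP : AnnulusPressure C₀ Cp) (hG : ProfileGevreyBound C₀ (2 * Real.exp (s₀ / 2)) C₁ θ)
    (hC₁ : 1 ≤ C₁) (hθ : 0 < θ) (hθ1 : θ ≤ 1) :
    ∀ c : ℝ, 1 < c → c ≤ Real.exp (θ / (4 * Real.log (9 * C₁ / (θ * δ₀)))) →
      ∀ (u : ℝ → EuclideanSpace ℝ (Fin 3) → EuclideanSpace ℝ (Fin 3)) (p : ℝ → EuclideanSpace ℝ (Fin 3) → ℝ),
        IsClassicalNSSolutionOn (Iio 0) 1 0 u p → IsDiscretelySelfSimilar c u → HasTypeIDecay C₀ u →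
        ∀ t < 0, ∀ x, u t x = 0 := by
  intro c hc hcc u p hsol hdss hdec
  have hLpos : 0 < Real.log (9 * C₁ / (θ * δ₀)) := by
    apply Real.log_pos
    rw [lt_div_iff₀ (mul_pos hθ hδ₀)]
    have : θ * δ₀ ≤ 1 := by nlinarith
    nlinarith
  have hwin : 2 * Real.log c ≤ θ / (2 * Real.log (9 * C₁ / (θ * δ₀))) := by
    have h := Real.log_le_log (lt_trans zero_lt_one hc) hcc
    rw [Real.log_exp] at h
    have h4 : θ / (4 * Real.log (9 * C₁ / (θ * δ₀))) * 2 = θ / (2 * Real.log (9 * C₁ / (θ * δ₀))) := by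
      field_simp
      ring
    linarith [h4]
  exact removingDss_analyticWindow_of stub_sliceDictionary hT hs₀ hδ₀ hδ₁ hP hG hC₁ hθ hθ1 c hc hwin u p
    hsol hdss hdec

/-- **∃-form of the rung WITH DEFINING CONJUNCTS (v3, critic P1's fix).**  For every `C₀ > 0` there are data
`δ₀, θ, C₁, Cp, s₀` which ARE a one-slice threshold, an annulus-pressure bound and Gevrey constants of the class on
the inspected ball (not merely numbers in a range), for which the analytic window excludes DSS.  Uses S2
(`profileGevreyBound_exists` ← `stub_profileGevreyBoundMild`) and the landed `oneSliceThreshold_exists`,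
`stub_annulusPressure` (p630589). -/
theorem analyticWindow_rung_exists :
    ∀ C₀ : ℝ, 0 < C₀ → ∃ δ₀ θ C₁ Cp s₀ : ℝ,
      OneSliceThresholdAt C₀ δ₀ Cp s₀ ∧ AnnulusPressure C₀ Cp ∧ ProfileGevreyBound C₀ (2 * Real.exp (s₀ / 2)) C₁ θ ∧
      0 < δ₀ ∧ δ₀ ≤ 1 ∧ 0 < θ ∧ θ ≤ 1 ∧ 1 ≤ C₁ ∧ 0 < Cp ∧ 1 ≤ s₀ ∧
      ∀ c : ℝ, 1 < c → c ≤ Real.exp (θ / (4 * Real.log (9 * C₁ / (θ * δ₀)))) →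
        ∀ (u : ℝ → EuclideanSpace ℝ (Fin 3) → EuclideanSpace ℝ (Fin 3))
          (p : ℝ → EuclideanSpace ℝ (Fin 3) → ℝ),
          IsClassicalNSSolutionOn (Iio 0) 1 0 u p → IsDiscretelySelfSimilar c u → HasTypeIDecay C₀ u →
          ∀ t < 0, ∀ x, u t x = 0 := by
  intro C₀ hC₀
  obtain ⟨δ₁, hT⟩ := oneSliceThreshold_exists C₀ hC₀
  obtain ⟨Cp, hCp, hP⟩ := stub_annulusPressure C₀ hC₀
  obtain ⟨s₀, hs₀, hTat⟩ := oneSliceThresholdAt_of hT hCp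
  have hR : 0 < 2 * Real.exp (s₀ / 2) := by positivity
  obtain ⟨C₁, θ, hC₁, hθ, hθ1, hG⟩ := profileGevreyBound_exists C₀ hC₀ (2 * Real.exp (s₀ / 2)) hR
  -- shrink the threshold to `δ₀ = min δ₁ 1` (still a threshold: `OneSliceThresholdAt.mono`)
  set δ₀ : ℝ := min δ₁ 1 with hδdef
  have hδ₀ : 0 < δ₀ := lt_min hT.1 zero_lt_one
  have hδle : δ₀ ≤ 1 := min_le_right _ _
  have hTat' : OneSliceThresholdAt C₀ δ₀ Cp s₀ := hTat.mono (min_le_left _ _)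
  exact ⟨δ₀, θ, C₁, Cp, s₀, hTat', hP, hG, hδ₀, hδle, hθ, hθ1, hC₁, hCp, hs₀,
    fun c hc hcc u p hsol hdss hdec => analyticWindow_rung hTat' hs₀ hδ₀ hδle hP hG hC₁ hθ hθ1 c hc hcc u p hsol hdss hdec⟩

/-- The v1/v2 ∃-RANGES form (record only).  HONEST NOTE (idea-crit-7 g3, kernel): AS TYPED this Prop FOLLOWS from
the tree rung `removingDss_explicitWindow` (p633176) by arithmetic alone (choose `θ = 1`, `C₁ = max 1 e^{B/(2δ₀)}`),
because its `∃` hides the defining properties of `δ₀, θ, C₁`; it is therefore NOT the rung of this line —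
`analyticWindow_rung` / `analyticWindow_rung_exists` are. -/
theorem analyticWindow_rung_ranges :
    ∀ C₀ : ℝ, 0 < C₀ → ∃ δ₀ θ C₁ : ℝ, 0 < δ₀ ∧ δ₀ ≤ 1 ∧ 0 < θ ∧ θ ≤ 1 ∧ 1 ≤ C₁ ∧
      ∀ c : ℝ, 1 < c → c ≤ Real.exp (θ / (4 * Real.log (9 * C₁ / (θ * δ₀)))) →
        ∀ (u : ℝ → EuclideanSpace ℝ (Fin 3) → EuclideanSpace ℝ (Fin 3))
          (p : ℝ → EuclideanSpace ℝ (Fin 3) → ℝ),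
          IsClassicalNSSolutionOn (Iio 0) 1 0 u p → IsDiscretelySelfSimilar c u → HasTypeIDecay C₀ u →
          ∀ t < 0, ∀ x, u t x = 0 := by
  intro C₀ hC₀
  obtain ⟨δ₀, θ, C₁, Cp, s₀, _, _, _, hδ₀, hδle, hθ, hθ1, hC₁, _, _, h⟩ := analyticWindow_rung_exists C₀ hC₀
  exact ⟨δ₀, θ, C₁, hδ₀, hδle, hθ, hθ1, hC₁, h⟩

end Summit.NavierStokesRegularity.NavierStokesRegularity.Cruxes.TypeIQuantSubcubicExp.AnalyticWindow

end
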